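import Summits.BirchSwinnertonDyer.BirchSwinnertonDyer.Theorems.AlignedTransportAtTwoMainConjectureTransportAlignedAtTwoKilfordCopyCrossLevel
import Summits.BirchSwinnertonDyer.BirchSwinnertonDyer.Theorems.AlignedTransportAtTwoMainConjectureTransportAlignedAtTwoKilfordCopyOfPrint
import HarnessLib

/-!
# Crux C1 `MainConjectureTransportAlignedAtTwo` (stmt-BirchSwinnertonDyer-22296), line `birth`, residual (R2) `stub_lamLawKilford`, UNEQUAL conductors:
# THE INTERMEDIATE-LEVEL REDUCTION — (i) the TWO-SIDED shape `L = N₁q₂ = N₂q₁`, (ii) the inline cross-level stub ON THE SHAPE `N(W₂) = N(W₁)·q`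
# in its own binder currency, from «PLANE(2) at level N(W₂)» + the Kraus–Oesterlé parity (width seat att-p3 g18; `--supports 22296`)

THEOREMS ONLY (no `def`, no `sorry`, no named fact). Sequel of `…KilfordCopyCrossLevel` (`oldLine_absorb`, `uniformize_depleted_iff_of_oldLine_conductor`).
Pure period bookkeeping plus binder plumbing; nothing about Galois representations, alignment or the main conjecture is used or asserted; BSD is not
proved by this; C1 is not closed by this; the cross-level input of (R2) is REDUCED, not discharged.

* §1 **`sameKernel_depleted_of_sameKernel_twoOldLines`** — each conductor carries ONE prime the other lacks (`L = N₁q₂ = N₂q₁`; parities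
  `a_{qⱼ}(fᵢ)` even for `i ≠ j`, odd for `i = j`; `a_ℓ(f₁) ≡ a_ℓ(f₂)` on `S ∖ {q₁, q₂}`): `oldLine_absorb` on BOTH sides with ONE integer operator
  (Euler data of `f₁` at `q₁`, of `f₂` elsewhere, `E' = 𝟙_{ℓ∤L}`); the level-`L` hypothesis is «same half-kernel of `(c₁·y(F₁), c₂·y(F₂))` on
  `H₁(X₀(L);ℤ)`» for the two old lines `Fᵢ = fᵢ + qⱼ·fᵢ(qⱼ·)`.
* §2 **`sameDepletedKernel_conductorMul_of_oldLinePlane`** — the body of v27's inline stub `stub_sameDepletedCopyKilfordNe` (`hCopyNe` of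
  `…OfPrintAndCopySplit`) with its binder `N(W₁) ≠ N(W₂)` specialised to `q prime, q ∤ N(W₁), N(W₂) = N(W₁)·q` (both cell′ members: M2
  `503c1 → 14587b1`, M3 `2071a1 → 6213a1`), FROM two inputs in the same binder currency: `hPlane` («same half-kernel at level `N(W₂)` of
  `(c₁·y(F₁), c₂·y(f₂))`, `F₁` the `q`-old line» = PLANE(2) at the intermediate level, H12♯-shaped under `F1Sign2.MultiplicityTwoOnStratumAtTwo`
  at `(W₂, N(W₂), f₂)` — memo `Cruxes/…/CROSS-LEVEL-att-p3-g18.md` §4) and `hKO` (`a_q(W₁)` even: Kraus–Oesterlé 1992 Prop. 3 second clause at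
  `p = 2`); `S = primeFactors(N₁N₂) ∖ {2}`, `N' = N₁N₂∏ℓ²`, the old line and the other parities are discharged inside.
The general shape (several extra primes per side, additive primes) needs the iterated absorption `F = f | ∏_{q∈Q}(1 + qV_q)`; not done here.

References: Greenberg–Vatsal 2000 §3 [GreenbergVatsal2000]; Emerton–Pollack–Weston 2006 §3 [EmertonPollackWeston2006]; Cremona 1997 §2.4, §2.10
[CremonaAlgorithms1997]; Kraus–Oesterlé 1992 Prop. 3 [KrausOesterle1992]; Kilford–Wiese 2008 Question 1.9 (reading only) [KilfordWiese2008].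
-/

noncomputable section

-- justification: the `Summit.BirchSwinnertonDyer.BirchSwinnertonDyer.…` path repeats a component (route-file convention)
set_option linter.dupNamespace false
set_option autoImplicit false

open scoped MatrixGroups ModularForm Classical

open CongruenceSubgroup Complex WeierstrassCurve Polynomial
open Literature.NumberTheory.EllipticCurves Literature.NumberTheory.EllipticCurves.ModularForms
open Literature.NumberTheory.EllipticCurves.Greenberg1999
open Summit.BirchSwinnertonDyer.Rank1Residual.F1Sign2
open Summit.BirchSwinnertonDyer.BirchSwinnertonDyer.Theorems.ThetaLayerLambdaCongruenceAtTwo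
open Summit.BirchSwinnertonDyer.BirchSwinnertonDyer.Theorems.AlignedTransportAtTwoDepletedPeriodFormula

namespace Summit.BirchSwinnertonDyer.BirchSwinnertonDyer.Theorems.AlignedTransportAtTwoKilfordCopyCrossLevelShapes

open Summit.BirchSwinnertonDyer.BirchSwinnertonDyer.Theorems.AlignedTransportAtTwoKilfordCopyCrossLevelTools
open Summit.BirchSwinnertonDyer.BirchSwinnertonDyer.Theorems.AlignedTransportAtTwoKilfordCopyCrossLevel

/-! ## §1 Two old lines: `L = N₁q₂ = N₂q₁` — both sides absorbed to the common level -/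

/-- **Cross-level same-kernel from the intermediate level, TWO-SIDED (abstract lattices).** `fᵢ ∈ S₂(Γ₀(Nᵢ))` Hecke eigenforms with integer
coefficients `Aᵢ`; distinct primes `q₁ ≠ q₂` with `q₂ ∤ N₁`, `q₁ ∤ N₂` and a common level `L = N₁q₂ = N₂q₁`; parities `a_{q₂}(f₁)` even,
`a_{q₁}(f₁)` odd, `a_{q₁}(f₂)` even, `a_{q₂}(f₂)` odd (each curve good with unipotent `ρ̄(Frob)` at the other's extra prime, multiplicative at its
own); `S ∋ q₁, q₂` odd primes with `a_ℓ(f₁) ≡ a_ℓ(f₂)` off `{q₁, q₂}`; `gᵢ` the `S`-depleted forms at `N'` with `L∏ℓ² ∣ N'`; old lines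
`F₁ = f₁ + q₂·f₁(q₂·)`, `F₂ = f₂ + q₁·f₂(q₁·)` at level `L`; `Λᵢ ⊇ cᵢΛ_{fᵢ}`. IF the half-kernels of `y ↦ cᵢ·y(Fᵢ)` on `H₁(X₀(L);ℤ)` agree THEN the
half-kernels of the depleted functionals on `H₁(X₀(N');ℤ)` agree (`oldLine_absorb` on both sides with ONE integer operator).
[cite: GreenbergVatsal2000, §3] [cite: EmertonPollackWeston2006, §3 (3.4)–(3.5)] [cite: CremonaAlgorithms1997, §2.4] -/
theorem sameKernel_depleted_of_sameKernel_twoOldLines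
    {N₁ N₂ L : ℕ} [NeZero N₁] [NeZero N₂] [NeZero L] {q₁ q₂ : ℕ} (hq₁ : q₁.Prime) (hq₂ : q₂.Prime) (hne : q₁ ≠ q₂)
    (hq₂N₁ : ¬ q₂ ∣ N₁) (hq₁N₂ : ¬ q₁ ∣ N₂) (hL₁ : L = N₁ * q₂) (hL₂ : L = N₂ * q₁)
    (f₁ : CuspForm (Gamma0 N₁) 2) (f₂ : CuspForm (Gamma0 N₂) 2)
    (A₁ A₂ : ℕ → ℤ) (hA₁ : ∀ n, cuspCoeff f₁ n = A₁ n) (hA₂ : ∀ n, cuspCoeff f₂ n = A₂ n)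
    (hT₁ : ∀ (p : ℕ) (hp : p.Prime), (haveI : NeZero p := ⟨hp.ne_zero⟩; heckeT (Gamma0 N₁) 2 p f₁) = cuspCoeff f₁ p • f₁)
    (hT₂ : ∀ (p : ℕ) (hp : p.Prime), (haveI : NeZero p := ⟨hp.ne_zero⟩; heckeT (Gamma0 N₂) 2 p f₂) = cuspCoeff f₂ p • f₂)
    (h₁₂ : Even (A₁ q₂)) (h₁₁ : Odd (A₁ q₁)) (h₂₁ : Even (A₂ q₁)) (h₂₂ : Odd (A₂ q₂))
    (S : Finset ℕ) (hS : ∀ ℓ ∈ S, ℓ.Prime) (hSodd : ∀ ℓ ∈ S, Odd ℓ) (hq₁S : q₁ ∈ S) (hq₂S : q₂ ∈ S)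
    (hAS : ∀ ℓ ∈ S, ℓ ≠ q₁ → ℓ ≠ q₂ → (2 : ℤ) ∣ A₁ ℓ - A₂ ℓ)
    (N' : ℕ) [NeZero N'] (hN' : L * ∏ ℓ ∈ S, ℓ ^ 2 ∣ N')
    (g₁ g₂ : CuspForm (Gamma0 N') 2)
    (hg₁ : ∀ n, cuspCoeff g₁ n = if ∃ ℓ ∈ S, ℓ ∣ n then 0 else cuspCoeff f₁ n)
    (hg₂ : ∀ n, cuspCoeff g₂ n = if ∃ ℓ ∈ S, ℓ ∣ n then 0 else cuspCoeff f₂ n)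
    (F₁ F₂ : CuspForm (Gamma0 L) 2)
    (hF₁ : ∀ n, cuspCoeff F₁ n = cuspCoeff f₁ n + (q₂ : ℂ) * (if q₂ ∣ n then cuspCoeff f₁ (n / q₂) else 0))
    (hF₂ : ∀ n, cuspCoeff F₂ n = cuspCoeff f₂ n + (q₁ : ℂ) * (if q₁ ∣ n then cuspCoeff f₂ (n / q₁) else 0))
    (Λ₁ Λ₂ : AddSubgroup ℂ) (c₁ c₂ : ℂ)
    (hc₁ : ∀ z ∈ periodLattice f₁, c₁ * z ∈ Λ₁) (hc₂ : ∀ z ∈ periodLattice f₂, c₂ * z ∈ Λ₂)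
    (hker : ∀ y ∈ periodHomology L, c₁ * y F₁ / 2 ∈ Λ₁ ↔ c₂ * y F₂ / 2 ∈ Λ₂) :
    ∀ x ∈ periodHomology N',
      c₁ * (((∏ ℓ ∈ S, ℓ ^ 2 : ℕ) : ℂ) * x g₁) / 2 ∈ Λ₁ ↔ c₂ * (((∏ ℓ ∈ S, ℓ ^ 2 : ℕ) : ℂ) * x g₂) / 2 ∈ Λ₂ := by
  classical
  intro x hx
  have hM0 : (∏ ℓ ∈ S, ℓ ^ 2) ≠ 0 := Finset.prod_ne_zero_iff.mpr fun ℓ hℓ ↦ pow_ne_zero 2 (hS ℓ hℓ).ne_zero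
  -- `x` is the period functional of one `γ ∈ Γ₀(N')`
  have hx' : x ∈ (periodHomology N' : Set (Module.Dual ℂ (CuspForm (Gamma0 N') 2))) := hx
  rw [coe_periodHomology_eq_range] at hx'
  obtain ⟨γ, rfl⟩ := hx'
  simp only [periodFunctional_apply]
  by_cases hγ : (γ : SL(2, ℤ)) 1 0 = 0
  · simp only [cuspSymbol, if_pos hγ, mul_zero, zero_div, Λ₁.zero_mem, Λ₂.zero_mem]
  set r : ℚ := (((γ : SL(2, ℤ)) 0 0 : ℚ) / ((γ : SL(2, ℤ)) 1 0 : ℚ)) with hr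
  have hcusp : ∀ g : CuspForm (Gamma0 N') 2, cuspSymbol g γ = modularSymbol g r := fun g ↦ by
    rw [cuspSymbol, if_neg hγ]
  rw [hcusp, hcusp]
  -- elementary divisibilities
  have hq₁L : q₁ ∣ L := by rw [hL₂]; exact Dvd.intro_left _ rfl
  have hq₂L : q₂ ∣ L := by rw [hL₁]; exact Dvd.intro_left _ rfl
  have hofL : ∀ {ℓ q N : ℕ}, ℓ.Prime → q.Prime → ℓ ≠ q → ℓ ∣ N * q → ℓ ∣ N := by
    intro ℓ q N hℓ hq hℓq h
    rcases (Nat.Prime.dvd_mul hℓ).mp h with h | h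
    · exact h
    · exact absurd ((Nat.prime_dvd_prime_iff_eq hℓ hq).mp h) hℓq
  have hq₁N₁ : q₁ ∣ N₁ := hofL hq₁ hq₂ hne (hL₁ ▸ hq₁L)
  have hq₂N₂ : q₂ ∣ N₂ := hofL hq₂ hq₁ hne.symm (hL₂ ▸ hq₂L)
  have hiff₁ : ∀ ℓ : ℕ, ℓ.Prime → ℓ ≠ q₂ → (ℓ ∣ N₁ ↔ ℓ ∣ L) := fun ℓ hℓ h2 ↦
    ⟨fun h ↦ hL₁ ▸ h.mul_right q₂, fun h ↦ hofL hℓ hq₂ h2 (hL₁ ▸ h)⟩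
  have hiff₂ : ∀ ℓ : ℕ, ℓ.Prime → ℓ ≠ q₁ → (ℓ ∣ N₂ ↔ ℓ ∣ L) := fun ℓ hℓ h1 ↦
    ⟨fun h ↦ hL₂ ▸ h.mul_right q₁, fun h ↦ hofL hℓ hq₁ h1 (hL₂ ▸ h)⟩
  -- ONE integer operator: `B'` = data of `f₁` at `q₁`, of `f₂` elsewhere; `E' = 𝟙_{ℓ ∤ L}`
  have hB₁ : ∀ ℓ ∈ S, ℓ ≠ q₂ → (2 : ℤ) ∣ -A₁ ℓ - (if ℓ = q₁ then -A₁ q₁ else -A₂ ℓ) := by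
    intro ℓ hℓ h2
    by_cases h1 : ℓ = q₁
    · subst h1; rw [if_pos rfl, sub_self]; exact dvd_zero 2
    · rw [if_neg h1, show -A₁ ℓ - -A₂ ℓ = -(A₁ ℓ - A₂ ℓ) by ring]
      exact (hAS ℓ hℓ h1 h2).neg_right
  have hE₁ : ∀ ℓ ∈ S, ℓ ≠ q₂ → (2 : ℤ) ∣ (if ℓ ∣ N₁ then 0 else 1) - (if ℓ ∣ L then 0 else 1 : ℤ) := by
    intro ℓ hℓ h2
    by_cases hN : ℓ ∣ N₁
    · rw [if_pos hN, if_pos ((hiff₁ ℓ (hS ℓ hℓ) h2).mp hN), sub_self]; exact dvd_zero 2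
    · rw [if_neg hN, if_neg (fun h ↦ hN ((hiff₁ ℓ (hS ℓ hℓ) h2).mpr h)), sub_self]; exact dvd_zero 2
  have hB₂ : ∀ ℓ ∈ S, ℓ ≠ q₁ → (2 : ℤ) ∣ -A₂ ℓ - (if ℓ = q₁ then -A₁ q₁ else -A₂ ℓ) := by
    intro ℓ _ h1
    rw [if_neg h1, sub_self]; exact dvd_zero 2
  have hE₂ : ∀ ℓ ∈ S, ℓ ≠ q₁ → (2 : ℤ) ∣ (if ℓ ∣ N₂ then 0 else 1) - (if ℓ ∣ L then 0 else 1 : ℤ) := by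
    intro ℓ hℓ h1
    by_cases hN : ℓ ∣ N₂
    · rw [if_pos hN, if_pos ((hiff₂ ℓ (hS ℓ hℓ) h1).mp hN), sub_self]; exact dvd_zero 2
    · rw [if_neg hN, if_neg (fun h ↦ hN ((hiff₂ ℓ (hS ℓ hℓ) h1).mpr h)), sub_self]; exact dvd_zero 2
  have hBq₂ : Odd ((fun ℓ ↦ if ℓ = q₁ then -A₁ q₁ else -A₂ ℓ) q₂) := by
    show Odd (if q₂ = q₁ then -A₁ q₁ else -A₂ q₂)
    rw [if_neg hne.symm]; exact h₂₂.neg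
  have hBq₁ : Odd ((fun ℓ ↦ if ℓ = q₁ then -A₁ q₁ else -A₂ ℓ) q₁) := by
    show Odd (if q₁ = q₁ then -A₁ q₁ else -A₂ q₁)
    rw [if_pos rfl]; exact h₁₁.neg
  obtain ⟨z₁, hz₁, e₁⟩ := oldLine_absorb hq₂ hq₂N₁ hL₁ f₁ A₁ hA₁ hT₁ h₁₂ S hS hSodd hq₂S
    (fun ℓ ↦ if ℓ = q₁ then -A₁ q₁ else -A₂ ℓ) (fun ℓ ↦ if ℓ ∣ L then 0 else 1) hB₁ hE₁ hBq₂ (if_pos hq₂L)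
    N' hN' g₁ hg₁ F₁ hF₁ Λ₁ c₁ hc₁ γ hγ
  obtain ⟨z₂, hz₂, e₂⟩ := oldLine_absorb hq₁ hq₁N₂ hL₂ f₂ A₂ hA₂ hT₂ h₂₁ S hS hSodd hq₁S
    (fun ℓ ↦ if ℓ = q₁ then -A₁ q₁ else -A₂ ℓ) (fun ℓ ↦ if ℓ ∣ L then 0 else 1) hB₂ hE₂ hBq₁ (if_pos hq₁L)
    N' hN' g₂ hg₂ F₂ hF₂ Λ₂ c₂ hc₂ γ hγ
  -- ONE cycle `y ∈ H₁(X₀(L);ℤ)` computing the common operator on every form of level `L`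
  obtain ⟨y, hy, hyH⟩ := exists_mem_periodHomology_apply_eq_act L (fun ℓ ↦ if ℓ = q₁ then -A₁ q₁ else -A₂ ℓ)
    (fun ℓ ↦ if ℓ ∣ L then 0 else 1) S r (fun m hm ↦
      exists_gamma0_dilate_cusp (ne_zero_of_dvd_ne_zero hM0 hm) ((mul_dvd_mul_left _ hm).trans hN') γ hγ)
  rw [← hyH F₁] at e₁
  rw [← hyH F₂] at e₂
  rw [div_two_mem_iff_of_eq_add Λ₁ hz₁ e₁, div_two_mem_iff_of_eq_add Λ₂ hz₂ e₂]
  exact hker y hy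

/-! ## §2 The inline cross-level stub of line `birth` on the conductor shape `N(W₂) = N(W₁)·q`, from PLANE(2) at level `N(W₂)` + the KO parity -/

/-- **The inline cross-level hypothesis of line `birth` (v27 `stub_sameDepletedCopyKilfordNe`, `hCopyNe` of `…OfPrintAndCopySplit`) ON THE CONDUCTOR SHAPE
`N(W₂) = N(W₁)·q` (`q` prime, `q ∤ N(W₁)` — both cell′ members), FROM TWO FIXED-LEVEL INPUTS stated in the same binder currency:**
`hPlane` — «same half-kernel at the intermediate level `N(W₂)`»: for the `q`-old line `F₁` of `D₁.f` (`a_n(F₁) = a_n(f₁) + q·a_{n/q}(f₁)`) and every cycle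
`y ∈ H₁(X₀(N(W₂));ℤ)`, `u₁(c₁·y(F₁)/2) = O ↔ u₂(c₂·y(f₂)/2) = O` (PLANE(2) at level `N(W₂)`: the old `E₁`-plane `(α₁* + α_q*)E₁^∨[2]` and `E₂^∨[2]` have the
same orthogonal in `J₀(N(W₂))[2]` — H12♯-shaped under `F1Sign2.MultiplicityTwoOnStratumAtTwo` at `(W₂, N(W₂), f₂)`, memo `CROSS-LEVEL-att-p3-g18.md` §4);
`hKO` — the level-raising parity `a_q(W₁)` EVEN (Kraus–Oesterlé 1992 Prop. 3 second clause at `p = 2`, via the Tate curve at `q`; not in the tree).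
The binders are those of `hCopyNe` with `W₁.conductorNorm ℤ ≠ W₂.conductorNorm ℤ` replaced by `q`, `q.Prime`, `¬ q ∣ N(W₁)`, `N(W₂) = N(W₁)·q`; all of
`S = primeFactors(N₁N₂) ∖ {2}`, `N' = N₁N₂∏ℓ²`, the other parities and the old line are discharged here. BSD is not proved by this; C1 is not closed by this.
[cite: GreenbergVatsal2000, §3] [cite: KrausOesterle1992, Prop. 3 (p. 262–263)] [cite: KilfordWiese2008, Question 1.9] [cite: CremonaAlgorithms1997, §2.4 and §2.10] -/
theorem sameDepletedKernel_conductorMul_of_oldLinePlane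
    (hPlane : ∀ (W₁ : WeierstrassCurve ℚ) [W₁.IsElliptic] [W₁.IsGloballyMinimal]
      (W₂ : WeierstrassCurve ℚ) [W₂.IsElliptic] [W₂.IsGloballyMinimal],
      IsOrdinaryAt W₁ 2 → IsOrdinaryAt W₂ 2 →
      (∀ x : ℚ, ¬ HasRationalTwoTorsionX W₁ x) → (∀ x : ℚ, ¬ HasRationalTwoTorsionX W₂ x) →
      ¬ IsSquare W₁.Δ → ¬ IsSquare W₂.Δ →
      (¬ ∃ (d : ℚ) (c : WeierstrassCurve.VariableChange ℚ), c • W₁.quadraticTwist d = W₂) →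
      OnKilfordStratumAtTwo W₁ →
      ∀ (q : ℕ), q.Prime → ¬ q ∣ W₁.conductorNorm ℤ → W₂.conductorNorm ℤ = W₁.conductorNorm ℤ * q →
      ∀ (F : Type) [Field F] [NumberField F], Module.finrank ℚ F = 3 →
      ∀ e₁ e₂ : F, aeval e₁ (twoDivisionUCubic W₁) = 0 → aeval e₂ (twoDivisionUCubic W₂) = 0 →
      AlignedAtTwo F e₁ e₂ → AlignedAtInfinity F (twoDivisionUCubic W₁) (twoDivisionUCubic W₂) e₁ e₂ →
      ∀ [NeZero (W₁.conductorNorm ℤ)] [NeZero (W₂.conductorNorm ℤ)]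
        (D₁ : ModularParametrizationData W₁ (W₁.conductorNorm ℤ)) (D₂ : ModularParametrizationData W₂ (W₂.conductorNorm ℤ)),
        Odd D₁.c → Odd D₂.c →
      ∀ (F₁ : CuspForm (Gamma0 (W₂.conductorNorm ℤ)) 2),
        (∀ n : ℕ, cuspCoeff F₁ n = cuspCoeff D₁.f n + (q : ℂ) * (if q ∣ n then cuspCoeff D₁.f (n / q) else 0)) →
      ∀ y ∈ periodHomology (W₂.conductorNorm ℤ),
        D₁.uniformize ((D₁.c : ℂ) * y F₁ / 2) = 0 ↔ D₂.uniformize ((D₂.c : ℂ) * y D₂.f / 2) = 0)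
    (hKO : ∀ (W₁ : WeierstrassCurve ℚ) [W₁.IsElliptic] [W₁.IsGloballyMinimal]
      (W₂ : WeierstrassCurve ℚ) [W₂.IsElliptic] [W₂.IsGloballyMinimal],
      IsOrdinaryAt W₁ 2 → IsOrdinaryAt W₂ 2 →
      (∀ x : ℚ, ¬ HasRationalTwoTorsionX W₁ x) → (∀ x : ℚ, ¬ HasRationalTwoTorsionX W₂ x) →
      ¬ IsSquare W₁.Δ → ¬ IsSquare W₂.Δ →
      ∀ (q : ℕ), q.Prime → ¬ q ∣ W₁.conductorNorm ℤ → W₂.conductorNorm ℤ = W₁.conductorNorm ℤ * q →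
      ∀ (F : Type) [Field F] [NumberField F], Module.finrank ℚ F = 3 →
      ∀ e₁ e₂ : F, aeval e₁ (twoDivisionUCubic W₁) = 0 → aeval e₂ (twoDivisionUCubic W₂) = 0 →
      Even (W₁.LFunction q)) :
    ∀ (W₁ : WeierstrassCurve ℚ) [W₁.IsElliptic] [W₁.IsGloballyMinimal]
      (W₂ : WeierstrassCurve ℚ) [W₂.IsElliptic] [W₂.IsGloballyMinimal],
      IsOrdinaryAt W₁ 2 → IsOrdinaryAt W₂ 2 →
      (∀ x : ℚ, ¬ HasRationalTwoTorsionX W₁ x) → (∀ x : ℚ, ¬ HasRationalTwoTorsionX W₂ x) →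
      ¬ IsSquare W₁.Δ → ¬ IsSquare W₂.Δ →
      (¬ ∃ (d : ℚ) (c : WeierstrassCurve.VariableChange ℚ), c • W₁.quadraticTwist d = W₂) →
      OnKilfordStratumAtTwo W₁ →
      ∀ (q : ℕ), q.Prime → ¬ q ∣ W₁.conductorNorm ℤ → W₂.conductorNorm ℤ = W₁.conductorNorm ℤ * q →
      ∀ (F : Type) [Field F] [NumberField F], Module.finrank ℚ F = 3 →
      ∀ e₁ e₂ : F, aeval e₁ (twoDivisionUCubic W₁) = 0 → aeval e₂ (twoDivisionUCubic W₂) = 0 →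
      AlignedAtTwo F e₁ e₂ → AlignedAtInfinity F (twoDivisionUCubic W₁) (twoDivisionUCubic W₂) e₁ e₂ →
      ∀ [NeZero (W₁.conductorNorm ℤ)] [NeZero (W₂.conductorNorm ℤ)]
        (D₁ : ModularParametrizationData W₁ (W₁.conductorNorm ℤ)) (D₂ : ModularParametrizationData W₂ (W₂.conductorNorm ℤ)),
        Odd D₁.c → Odd D₂.c →
      ∀ (N' : ℕ) [NeZero N'], N' = W₁.conductorNorm ℤ * W₂.conductorNorm ℤ *
          ∏ ℓ ∈ (W₁.conductorNorm ℤ * W₂.conductorNorm ℤ).primeFactors.erase 2, ℓ ^ 2 →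
      ∀ (g₁ g₂ : CuspForm (Gamma0 N') 2),
        (∀ n : ℕ, cuspCoeff g₁ n =
          if ∃ ℓ ∈ (W₁.conductorNorm ℤ * W₂.conductorNorm ℤ).primeFactors.erase 2, ℓ ∣ n then 0 else cuspCoeff D₁.f n) →
        (∀ n : ℕ, cuspCoeff g₂ n =
          if ∃ ℓ ∈ (W₁.conductorNorm ℤ * W₂.conductorNorm ℤ).primeFactors.erase 2, ℓ ∣ n then 0 else cuspCoeff D₂.f n) →
      ∀ x ∈ periodHomology N',
        D₁.uniformize ((D₁.c : ℂ) *
            ((((∏ ℓ ∈ (W₁.conductorNorm ℤ * W₂.conductorNorm ℤ).primeFactors.erase 2, ℓ ^ 2 : ℕ) : ℂ) * x g₁) / 2)) = 0 ↔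
          D₂.uniformize ((D₂.c : ℂ) *
            ((((∏ ℓ ∈ (W₁.conductorNorm ℤ * W₂.conductorNorm ℤ).primeFactors.erase 2, ℓ ^ 2 : ℕ) : ℂ) * x g₂) / 2)) = 0 := by
  intro W₁ _ _ W₂ _ _ hord₁ hord₂ ht₁ ht₂ hsq₁ hsq₂ htw hK q hq hqN₁ hN₂ F _ _ hF e₁ e₂ he₁ he₂ h2 hal _ _ D₁ D₂ hc₁ hc₂ N' _ hN' g₁ g₂ hg₁ hg₂
  classical
  set N₁ : ℕ := W₁.conductorNorm ℤ with hN₁def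
  set N₂ : ℕ := W₂.conductorNorm ℤ with hN₂def
  have hN₁0 : N₁ ≠ 0 := NeZero.ne _
  have hN₂0 : N₂ ≠ 0 := NeZero.ne _
  haveI : Fact (Nat.Prime 2) := ⟨Nat.prime_two⟩
  have h2N₂ : ¬ 2 ∣ N₂ := not_dvd_level_of_isNewformOf D₂.isNewformOf hord₂.1
  have hq2 : q ≠ 2 := by
    rintro rfl
    exact h2N₂ (by rw [hN₂]; exact Dvd.intro_left _ rfl)
  set S : Finset ℕ := (N₁ * N₂).primeFactors.erase 2 with hS
  have hSp : ∀ ℓ ∈ S, ℓ.Prime := fun ℓ hℓ ↦ Nat.prime_of_mem_primeFactors (Finset.mem_of_mem_erase hℓ)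
  have hSodd : ∀ ℓ ∈ S, Odd ℓ := fun ℓ hℓ ↦ (hSp ℓ hℓ).odd_of_ne_two (Finset.ne_of_mem_erase hℓ)
  have hqS : q ∈ S := by
    refine Finset.mem_erase.mpr ⟨hq2, Nat.mem_primeFactors.mpr ⟨hq, ?_, mul_ne_zero hN₁0 hN₂0⟩⟩
    rw [hN₂]; exact ⟨N₁ * N₁, by ring⟩
  have hSN : ∀ ℓ ∈ S, ℓ ≠ q → ℓ ∣ N₁ := by
    intro ℓ hℓ hℓq
    have hℓ' := (Nat.mem_primeFactors.mp (Finset.mem_of_mem_erase hℓ)).2.1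
    rw [hN₂, ← mul_assoc] at hℓ'
    rcases (Nat.Prime.dvd_mul (hSp ℓ hℓ)).mp hℓ' with h | h
    · rcases (Nat.Prime.dvd_mul (hSp ℓ hℓ)).mp h with h | h <;> exact h
    · exact absurd ((Nat.prime_dvd_prime_iff_eq (hSp ℓ hℓ) hq).mp h) hℓq
  have hN'' : N₂ * ∏ ℓ ∈ S, ℓ ^ 2 ∣ N' := ⟨N₁, by rw [hN']; ring⟩
  -- the old line at level `N₂ = N₁ q`
  obtain ⟨F₁, hF₁⟩ : ∃ F₁ : CuspForm (Gamma0 N₂) 2,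
      ∀ n : ℕ, cuspCoeff F₁ n = cuspCoeff D₁.f n + (q : ℂ) * (if q ∣ n then cuspCoeff D₁.f (n / q) else 0) := by
    rw [hN₂]
    haveI : NeZero q := ⟨hq.ne_zero⟩
    exact exists_oldLine q D₁.f
  exact uniformize_depleted_iff_of_oldLine_conductor D₁ D₂ hq hqN₁ hN₂
    (hKO W₁ W₂ hord₁ hord₂ ht₁ ht₂ hsq₁ hsq₂ q hq hqN₁ hN₂ F hF e₁ e₂ he₁ he₂) S hSp hSodd hqS hSN N' hN'' g₁ g₂ hg₁ hg₂ F₁ hF₁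
    (hPlane W₁ W₂ hord₁ hord₂ ht₁ ht₂ hsq₁ hsq₂ htw hK q hq hqN₁ hN₂ F hF e₁ e₂ he₁ he₂ h2 hal D₁ D₂ hc₁ hc₂ F₁ hF₁)

end Summit.BirchSwinnertonDyer.BirchSwinnertonDyer.Theorems.AlignedTransportAtTwoKilfordCopyCrossLevelShapes

end
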